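import Summits.BirchSwinnertonDyer.BirchSwinnertonDyer.Theorems.ErratumRoadFiveRegCertKernelFiveDepthOneO2
import HarnessLib

/-!
# Route `ErratumRoadFive` (rung K2, `p ≥ 5`), crux `RamNoErratumDataAtFive` (item stmt-BirchSwinnertonDyer-19624, REST‴):
# the SECOND-ORDER REG5CERT kernel checker at depth one — from one row's integers (`a, b, e', λ, Γ, β`) to
# `RegMult.CertNonsplit W 5 Q 1` when `v₅(h(Q)) ≤ 2`
# (cell `bsd-stepL`, OWNER seat `bsd-stepL-rest-p2` g7; `--supports stmt-BirchSwinnertonDyer-19624`)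

HONEST FRAMING: BSD is not proved by any of this; nothing here closes the crux; Schneider's non-degeneracy conjecture (barrier
`Literature.Barriers.BirchSwinnertonDyer.PAdicHeightNondegeneracy`) is asserted NOWHERE; every application is ONE curve. Assembly of
the second-order depth-one estimates of `Theorems/ErratumRoadFiveRegCertKernelFiveDepthOneO2.lean` (same seat) into the height
certificate: for `Q = (a/e², b/e³)`, `e = 5e'`, with `log_Ŵ(z(Q)) ≡ 5λ (mod 5⁴)` (cubic residue condition
`5³ ∣ −6ae'b² + 15a₁a²e'²b − 50(a₁²+a₂)a³e'³ − 6b³λ`), `C² ≡ Γ (mod 5)` (`5 ∣ c₄ + Γc₆`) and `12Γβ ≡ 12Γλ² + 25λ⁴ (mod 5³)`: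
`C²σ² ≡ 25β (mod 25·5⁻³)`, `den x = 25e'²`, and `h(Q) = 0` would force `5³ ∣ β⁴ − e'⁸`
(`KernelCertFive.padicLog_ne_padicLog_of_unitResidue`, `P = 25`, `N = 3`). Used at the branch-(D) witness D5 = 635b1 ⊗ (−3208) of crux
19624 (`v₅(h(6g)) = 2`). Theorems only (0 defs, 0 facts, no `native_decide`); route-free.
References: [SteinWuthrich2013] §4.2; [MazurSteinTate2006] §1; [SilvermanAEC2009] IV.6.4, VII.3.4; [Iwasawa1972PadicL] §4.4.
-/

open scoped Classical

open Filter Topology PowerSeries IsUltrametricDist WeierstrassCurve Literature.NumberTheory.EllipticCurves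
  Literature.NumberTheory.EllipticCurves.Rank1Residual
  Literature.NumberTheory.EllipticCurves.SteinWuthrich2013
  Summit.BirchSwinnertonDyer.Rank1Residual
  Summit.BirchSwinnertonDyer.Rank1Residual.X11b

namespace Summit.BirchSwinnertonDyer.Rank1Residual.X11b.RegMult.KernelCertFive

/-! ### §0 Plumbing in `ℚ₅` -/

/-- `‖5^k‖₅ = 1/5^k`. [folklore] -/
private theorem norm_five_pow₃ (k : ℕ) : ‖(5 : ℚ_[5]) ^ k‖ = 1 / (5 : ℝ) ^ k := by
  rw [norm_pow, show (5 : ℚ_[5]) = ((5 : ℕ) : ℚ_[5]) by norm_cast, Padic.norm_p]; simp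

/-- `‖5‖₅ = 5⁻¹`. [folklore] -/
private theorem norm_five₃ : ‖(5 : ℚ_[5])‖ = 1 / 5 := by
  rw [show (5 : ℚ_[5]) = (5 : ℚ_[5]) ^ 1 by norm_num, norm_five_pow₃]; norm_num

/-- `‖25‖₅ = 5⁻²`. [folklore] -/
private theorem norm_twentyfive₃ : ‖(25 : ℚ_[5])‖ = 1 / 25 := by
  rw [show (25 : ℚ_[5]) = (5 : ℚ_[5]) ^ 2 by norm_num, norm_five_pow₃]; norm_num

/-- `‖625‖₅ = 5⁻⁴`. [folklore] -/
private theorem norm_sixtwentyfive₃ : ‖(625 : ℚ_[5])‖ = 1 / 625 := by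
  rw [show (625 : ℚ_[5]) = (5 : ℚ_[5]) ^ 4 by norm_num, norm_five_pow₃]; norm_num

/-- `x = a/e²` in lowest terms has `den x = e²`. [folklore] -/
private theorem den_eq_sq₃ {a : ℤ} {e : ℕ} (he : e ≠ 0) (hcop : Nat.Coprime a.natAbs e) {x : ℚ}
    (hx : x = a / (e : ℚ) ^ 2) : x.den = e ^ 2 := by
  have hpos : (0 : ℤ) < ((e : ℕ) : ℤ) ^ 2 := by positivity
  have hcop2 : Nat.Coprime a.natAbs ((((e : ℕ) : ℤ) ^ 2).natAbs) := by
    rw [Int.natAbs_pow, Int.natAbs_natCast]; exact hcop.pow_right 2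
  have h := Rat.den_div_eq_of_coprime hpos hcop2
  have hx' : x = ((a : ℤ) : ℚ) / ((((e : ℕ) : ℤ) ^ 2 : ℤ) : ℚ) := by rw [hx]; push_cast; ring
  rw [← hx'] at h
  exact_mod_cast h

/-- `gcd(a, 5e') = 1 ⇒ 5 ∤ a`. [folklore] -/
private theorem not_five_dvd_of_coprime₃ {a : ℤ} {e' : ℕ} (hcop : Nat.Coprime a.natAbs (5 * e')) : ¬ (5 : ℤ) ∣ a := by
  intro h
  have h1 : 5 ∣ a.natAbs := Int.natCast_dvd.mp h
  have h2 : 5 ∣ Nat.gcd a.natAbs (5 * e') := Nat.dvd_gcd h1 (dvd_mul_right 5 e')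
  rw [hcop] at h2
  exact absurd (Nat.le_of_dvd one_pos h2) (by norm_num)

/-! ### §1 The second-order height certificate at depth one -/

section Height

variable (W : WeierstrassCurve ℚ) {a₁ a₂ a₃ a₄ a₆ : ℤ} (hW : W = ⟨a₁, a₂, a₃, a₄, a₆⟩)
include hW

/-- **The SECOND-ORDER REG5CERT certificate at DEPTH ONE.** Let `W/ℚ` be globally minimal with integer model `⟨a₁,…,a₆⟩` whose `c₄, c₆`
are `5`-adic units; `Q = (x, y) = (a/e², b/e³)`, `e = 5e'`, `5 ∤ e'`, `5 ∤ b`, `gcd(a, e) = 1`; integers `λ, Γ, β` with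
`5³ ∣ −6ae'b² + 15a₁a²e'²b − 50(a₁²+a₂)a³e'³ − 6b³λ` (`log_Ŵ(z) ≡ 5λ (mod 5⁴)`), `5 ∤ λ`, `5 ∣ c₄ + Γc₆` (`C² ≡ Γ`),
`5³ ∣ 12Γβ − 12Γλ² − 25λ⁴` (`C²σ² ≡ 25β`), `5 ∤ β`. If **`5³ ∤ β⁴ − e'⁸`** then `heightFourOneCoord W 5 q x y ≠ 0` for every `‖q‖₅ < 1`.
[cite: SteinWuthrich2013, §4.2] [cite: Iwasawa1972PadicL, §4.4] [cite: SilvermanAEC2009, IV.6.4] -/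
theorem heightFourOneCoord_ne_zero_of_certDepthOneO2 [W.IsGloballyMinimal] {a b c4 c6 lam Γ β : ℤ} {e' : ℕ}
    (hc4 : c4 = (a₁ ^ 2 + 4 * a₂) ^ 2 - 24 * (2 * a₄ + a₁ * a₃))
    (hc6 : c6 = -(a₁ ^ 2 + 4 * a₂) ^ 3 + 36 * (a₁ ^ 2 + 4 * a₂) * (2 * a₄ + a₁ * a₃) - 216 * (a₃ ^ 2 + 4 * a₆))
    (h5c4 : ¬ (5 : ℤ) ∣ c4) (h5c6 : ¬ (5 : ℤ) ∣ c6) (h5e : ¬ (5 : ℤ) ∣ e') (h5b : ¬ (5 : ℤ) ∣ b)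
    (hcop : Nat.Coprime a.natAbs (5 * e'))
    {x y : ℚ} (hx : x = a / ((5 * e' : ℕ) : ℚ) ^ 2) (hy : y = b / ((5 * e' : ℕ) : ℚ) ^ 3)
    (hlam : (125 : ℤ) ∣ -6 * a * e' * b ^ 2 + 15 * a₁ * a ^ 2 * e' ^ 2 * b - 50 * (a₁ ^ 2 + a₂) * a ^ 3 * e' ^ 3
      - 6 * b ^ 3 * lam)
    (h5lam : ¬ (5 : ℤ) ∣ lam) (hΓ : (5 : ℤ) ∣ c4 + Γ * c6)
    (hβ : (125 : ℤ) ∣ 12 * Γ * β - 12 * Γ * lam ^ 2 - 25 * lam ^ 4) (h5β : ¬ (5 : ℤ) ∣ β)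
    (hcert : ¬ (5 : ℤ) ^ 3 ∣ β ^ 4 - ((e' : ℤ) ^ 2) ^ 4)
    {q : ℚ_[5]} (hq : ‖q‖ < 1) : heightFourOneCoord W 5 q x y ≠ 0 := by
  have h5a : ¬ (5 : ℤ) ∣ a := not_five_dvd_of_coprime₃ hcop
  have he'0 : e' ≠ 0 := by rintro rfl; exact h5e (by simp)
  have hP5 : Prime (5 : ℤ) := Int.prime_iff_natAbs_prime.mpr (by norm_num)
  set V := W.baseChange ℚ_[5] with hV
  have ha1 : V.a₁ = a₁ := baseChange_a₁_eq W hW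
  have ha2 : V.a₂ = a₂ := baseChange_a₂_eq W hW
  -- the parameter `z = −x/y = −5ae'/b`, `‖z‖ = 5⁻¹`
  set z : ℚ_[5] := -(x : ℚ_[5]) / y with hz
  have hbn : ‖(b : ℚ_[5])‖ = 1 := norm_intCast_eq_one_of_not_dvd h5b
  have hb0 : (b : ℚ_[5]) ≠ 0 := by intro h; rw [h, norm_zero] at hbn; exact zero_ne_one hbn
  have hen : ‖((e' : ℤ) : ℚ_[5])‖ = 1 := norm_intCast_eq_one_of_not_dvd h5e
  have he0 : ((e' : ℤ) : ℚ_[5]) ≠ 0 := by intro h; rw [h, norm_zero] at hen; exact zero_ne_one hen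
  have he0' : (e' : ℚ_[5]) ≠ 0 := by exact_mod_cast he0
  have hae : ‖((-a * e' : ℤ) : ℚ_[5])‖ = 1 := by
    rw [Int.cast_mul, norm_mul, Int.cast_neg, norm_neg, norm_intCast_eq_one_of_not_dvd h5a, hen, one_mul]
  have hzval : z = 5 * ((-a * e' : ℤ) : ℚ_[5]) / (b : ℚ_[5]) := by
    have h50 : (5 : ℚ_[5]) ≠ 0 := by norm_num
    rw [hz, hx, hy]; push_cast; field_simp
  have hzn : ‖z‖ = 1 / 5 := by rw [hzval, norm_div, norm_mul, norm_five₃, hae, hbn]; norm_num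
  -- the formal logarithm to third order and the residue `λ`
  have hFL := norm_padicFormalLog_sub_cubic_le_depthOne V hzn.le
  rw [ha1, ha2] at hFL
  have hres : ‖(z + (2 : ℚ_[5])⁻¹ * (a₁ : ℚ_[5]) * z ^ 2 + (3 : ℚ_[5])⁻¹ * ((a₁ : ℚ_[5]) ^ 2 + (a₂ : ℚ_[5])) * z ^ 3)
      - 5 * (lam : ℚ_[5])‖ ≤ 1 / 5 ^ 4 := by
    have hid : (z + (2 : ℚ_[5])⁻¹ * (a₁ : ℚ_[5]) * z ^ 2 + (3 : ℚ_[5])⁻¹ * ((a₁ : ℚ_[5]) ^ 2 + (a₂ : ℚ_[5])) * z ^ 3)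
        - 5 * (lam : ℚ_[5]) =
        5 * (((-6 * a * e' * b ^ 2 + 15 * a₁ * a ^ 2 * e' ^ 2 * b - 50 * (a₁ ^ 2 + a₂) * a ^ 3 * e' ^ 3
          - 6 * b ^ 3 * lam : ℤ)) : ℚ_[5]) / ((6 * b ^ 3 : ℤ) : ℚ_[5]) := by
      have h20 : (2 : ℚ_[5]) ≠ 0 := by norm_num
      have h30 : (3 : ℚ_[5]) ≠ 0 := by norm_num
      rw [hzval]; push_cast; field_simp; ring
    rw [hid, norm_div, norm_mul, norm_five₃]
    have hK : ‖(((-6 * a * e' * b ^ 2 + 15 * a₁ * a ^ 2 * e' ^ 2 * b - 50 * (a₁ ^ 2 + a₂) * a ^ 3 * e' ^ 3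
          - 6 * b ^ 3 * lam : ℤ)) : ℚ_[5])‖ ≤ 1 / 125 := by
      refine ((Padic.norm_int_le_pow_iff_dvd (p := 5) _ 3).mpr (by exact_mod_cast hlam)).trans ?_
      norm_num
    have hD : ‖((6 * b ^ 3 : ℤ) : ℚ_[5])‖ = 1 :=
      norm_intCast_eq_one_of_not_dvd (by
        intro h
        rcases hP5.dvd_or_dvd h with h6 | hb3
        · norm_num at h6
        · exact h5b (hP5.dvd_of_dvd_pow hb3))
    rw [hD, div_one]
    calc 1 / 5 * ‖(((-6 * a * e' * b ^ 2 + 15 * a₁ * a ^ 2 * e' ^ 2 * b - 50 * (a₁ ^ 2 + a₂) * a ^ 3 * e' ^ 3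
          - 6 * b ^ 3 * lam : ℤ)) : ℚ_[5])‖ ≤ 1 / 5 * (1 / 125) := by gcongr
      _ = 1 / 5 ^ 4 := by norm_num
  have hL : ‖V.padicFormalLog z - 5 * (lam : ℚ_[5])‖ ≤ 1 / 5 ^ 4 := by
    have : V.padicFormalLog z - 5 * (lam : ℚ_[5]) =
        (V.padicFormalLog z - (z + (2 : ℚ_[5])⁻¹ * (a₁ : ℚ_[5]) * z ^ 2 +
          (3 : ℚ_[5])⁻¹ * ((a₁ : ℚ_[5]) ^ 2 + (a₂ : ℚ_[5])) * z ^ 3)) +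
        ((z + (2 : ℚ_[5])⁻¹ * (a₁ : ℚ_[5]) * z ^ 2 + (3 : ℚ_[5])⁻¹ * ((a₁ : ℚ_[5]) ^ 2 + (a₂ : ℚ_[5])) * z ^ 3)
          - 5 * (lam : ℚ_[5])) := by ring
    rw [this]
    exact (IsUltrametricDist.norm_add_le_max _ _).trans (max_le hFL hres)
  have hlamn : ‖(lam : ℚ_[5])‖ = 1 := norm_intCast_eq_one_of_not_dvd h5lam
  have h5lamn : ‖(5 * (lam : ℚ_[5]))‖ = 1 / 5 := by rw [norm_mul, norm_five₃, hlamn, mul_one]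
  have hLn : ‖V.padicFormalLog z‖ = 1 / 5 := by
    have hlt : ‖V.padicFormalLog z - 5 * (lam : ℚ_[5])‖ < ‖(5 * (lam : ℚ_[5]))‖ := by
      rw [h5lamn]; exact hL.trans_lt (by norm_num)
    rw [Padic.norm_eq_of_norm_sub_lt_right hlt, h5lamn]
  set L := V.padicFormalLog z with hLdef
  -- the scale: a unit, within `5⁻¹` of `Γ`
  set C2 := uniformisationScaleSq W 5 q with hC2def
  have hC2 : ‖C2‖ = 1 := norm_uniformisationScaleSq_eq_one_of_units W hW hc4 hc6 h5c4 h5c6 hq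
  have hC20 : C2 ≠ 0 := uniformisationScaleSq_ne_zero_of_units W hW hc4 hc6 h5c4 h5c6 hq
  have hC2Γ : ‖C2 - Γ‖ ≤ 1 / 5 := norm_uniformisationScaleSq_sub_le_of_congr W hW hc4 hc6 h5c4 h5c6 hΓ hq
  have h5Γ : ¬ (5 : ℤ) ∣ Γ := by
    intro h
    obtain ⟨k, hk⟩ := hΓ
    obtain ⟨m, hm⟩ := h
    exact h5c4 ⟨k - m * c6, by linear_combination hk - c6 * hm⟩
  have hΓn : ‖(Γ : ℚ_[5])‖ = 1 := norm_intCast_eq_one_of_not_dvd h5Γ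
  have hΓ0 : (Γ : ℚ_[5]) ≠ 0 := by intro h; rw [h, norm_zero] at hΓn; exact zero_ne_one hΓn
  -- `w = L²/C²`, `‖w‖ ≤ 5⁻²`; `σ² = w + w²/12 + O(5⁻⁵)`
  have hwdef : logUnitParamSq W 5 q x y = L ^ 2 / C2 := by rw [logUnitParamSq]
  set w := logUnitParamSq W 5 q x y with hw
  have hwn : ‖w‖ ≤ 1 / 25 := by rw [hwdef, norm_div, norm_pow, hLn, hC2]; norm_num
  have hS := norm_tateSigmaSq_sub_quadratic_le_depthOne hq hwn
  set S2 := tateSigmaSq q (coshOfSq w) with hS2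
  have h12n : ‖(12 : ℚ_[5])‖ = 1 := by
    rw [show (12 : ℚ_[5]) = ((12 : ℤ) : ℚ_[5]) by norm_cast]; exact norm_intCast_eq_one_of_not_dvd (by decide)
  have h120 : (12 : ℚ_[5]) ≠ 0 := by norm_num
  -- the four pieces of `C²σ² − 25β`
  have hT1 : ‖C2 * (S2 - (w + w ^ 2 / 12))‖ ≤ 1 / 5 ^ 5 := by rw [norm_mul, hC2, one_mul]; exact hS
  have hCw : C2 * w = L ^ 2 := by rw [hwdef]; field_simp
  have hCw2 : C2 * (w ^ 2 / 12) = L ^ 4 / (12 * C2) := by rw [hwdef]; field_simp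
  have hL2 : ‖L ^ 2 - (5 * (lam : ℚ_[5])) ^ 2‖ ≤ 1 / 5 ^ 5 := by
    rw [sq_sub_sq, norm_mul]
    have hplus : ‖L + 5 * (lam : ℚ_[5])‖ ≤ 1 / 5 :=
      (IsUltrametricDist.norm_add_le_max _ _).trans (max_le hLn.le h5lamn.le)
    calc ‖L + 5 * (lam : ℚ_[5])‖ * ‖L - 5 * (lam : ℚ_[5])‖ ≤ 1 / 5 * (1 / 5 ^ 4) := by gcongr
      _ = 1 / 5 ^ 5 := by norm_num
  have hL4 : ‖L ^ 4 - (5 * (lam : ℚ_[5])) ^ 4‖ ≤ 1 / 5 ^ 7 := by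
    have hid : L ^ 4 - (5 * (lam : ℚ_[5])) ^ 4 = (L ^ 2 - (5 * (lam : ℚ_[5])) ^ 2) * (L ^ 2 + (5 * (lam : ℚ_[5])) ^ 2) := by
      ring
    rw [hid, norm_mul]
    have hplus : ‖L ^ 2 + (5 * (lam : ℚ_[5])) ^ 2‖ ≤ 1 / 25 := by
      refine (IsUltrametricDist.norm_add_le_max _ _).trans (max_le ?_ ?_)
      · rw [norm_pow, hLn]; norm_num
      · rw [norm_pow, h5lamn]; norm_num
    calc ‖L ^ 2 - (5 * (lam : ℚ_[5])) ^ 2‖ * ‖L ^ 2 + (5 * (lam : ℚ_[5])) ^ 2‖ ≤ 1 / 5 ^ 5 * (1 / 25) := by gcongr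
      _ = 1 / 5 ^ 7 := by norm_num
  -- second-order term: `L⁴/(12C²) − 625λ⁴/(12Γ)`
  have hT3 : ‖L ^ 4 / (12 * C2) - 625 * (lam : ℚ_[5]) ^ 4 / (12 * Γ)‖ ≤ 1 / 5 ^ 5 := by
    have hid : L ^ 4 / (12 * C2) - 625 * (lam : ℚ_[5]) ^ 4 / (12 * Γ) =
        ((Γ : ℚ_[5]) * (L ^ 4 - (5 * (lam : ℚ_[5])) ^ 4) + (5 * (lam : ℚ_[5])) ^ 4 * ((Γ : ℚ_[5]) - C2)) /
          (12 * C2 * Γ) := by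
      field_simp; ring
    rw [hid, norm_div, norm_mul, norm_mul, h12n, hC2, hΓn]
    simp only [mul_one, div_one]
    refine (IsUltrametricDist.norm_add_le_max _ _).trans (max_le ?_ ?_)
    · rw [norm_mul, hΓn, one_mul]; exact hL4.trans (by norm_num)
    · rw [norm_mul, norm_pow, h5lamn, ← norm_neg ((Γ : ℚ_[5]) - C2), neg_sub]
      calc (1 / 5 : ℝ) ^ 4 * ‖C2 - Γ‖ ≤ (1 / 5 : ℝ) ^ 4 * (1 / 5) := by gcongr
        _ = 1 / 5 ^ 5 := by norm_num
  -- the integer residue `β`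
  have hT4 : ‖(25 * (lam : ℚ_[5]) ^ 2 + 625 * (lam : ℚ_[5]) ^ 4 / (12 * Γ)) - 25 * (β : ℚ_[5])‖ ≤ 1 / 5 ^ 5 := by
    have hid : (25 * (lam : ℚ_[5]) ^ 2 + 625 * (lam : ℚ_[5]) ^ 4 / (12 * Γ)) - 25 * (β : ℚ_[5]) =
        25 * (-(((12 * Γ * β - 12 * Γ * lam ^ 2 - 25 * lam ^ 4 : ℤ)) : ℚ_[5])) / ((12 * Γ : ℤ) : ℚ_[5]) := by
      push_cast; field_simp; ring
    rw [hid, norm_div, norm_mul, norm_neg, norm_twentyfive₃]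
    have hK : ‖(((12 * Γ * β - 12 * Γ * lam ^ 2 - 25 * lam ^ 4 : ℤ)) : ℚ_[5])‖ ≤ 1 / 125 := by
      refine ((Padic.norm_int_le_pow_iff_dvd (p := 5) _ 3).mpr (by exact_mod_cast hβ)).trans ?_
      norm_num
    have hD : ‖((12 * Γ : ℤ) : ℚ_[5])‖ = 1 := by push_cast; rw [norm_mul, h12n, hΓn, one_mul]
    rw [hD, div_one]
    calc 1 / 25 * ‖(((12 * Γ * β - 12 * Γ * lam ^ 2 - 25 * lam ^ 4 : ℤ)) : ℚ_[5])‖ ≤ 1 / 25 * (1 / 125) := by gcongr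
      _ = 1 / 5 ^ 5 := by norm_num
  have hB : ‖C2 * S2 - 25 * (β : ℚ_[5])‖ ≤ ‖(25 : ℚ_[5])‖ / (5 : ℝ) ^ 3 := by
    have hid : C2 * S2 - 25 * (β : ℚ_[5]) =
        C2 * (S2 - (w + w ^ 2 / 12)) + ((C2 * w - L ^ 2) + (C2 * (w ^ 2 / 12) - L ^ 4 / (12 * C2))) +
        ((L ^ 2 - (5 * (lam : ℚ_[5])) ^ 2) +
          ((L ^ 4 / (12 * C2) - 625 * (lam : ℚ_[5]) ^ 4 / (12 * Γ)) +
            ((25 * (lam : ℚ_[5]) ^ 2 + 625 * (lam : ℚ_[5]) ^ 4 / (12 * Γ)) - 25 * (β : ℚ_[5])))) := by ring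
    rw [hid, hCw, hCw2, sub_self, sub_self, add_zero, add_zero, norm_twentyfive₃]
    refine (IsUltrametricDist.norm_add_le_max _ _).trans (max_le (hT1.trans (by norm_num)) ?_)
    refine (IsUltrametricDist.norm_add_le_max _ _).trans (max_le (hL2.trans (by norm_num)) ?_)
    exact (IsUltrametricDist.norm_add_le_max _ _).trans (max_le (hT3.trans (by norm_num)) (hT4.trans (by norm_num)))
  -- `den x = 25e'²`
  have hden : x.den = (5 * e') ^ 2 := den_eq_sq₃ (by positivity) hcop hx
  have hA : ‖(((x.den : ℚ)) : ℚ_[5]) - 25 * ((((e' : ℤ)) ^ 2 : ℤ) : ℚ_[5])‖ ≤ ‖(25 : ℚ_[5])‖ / (5 : ℝ) ^ 3 := by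
    have h0 : (((x.den : ℚ)) : ℚ_[5]) - 25 * ((((e' : ℤ)) ^ 2 : ℤ) : ℚ_[5]) = 0 := by
      rw [hden]; push_cast; ring
    rw [h0, norm_zero]
    positivity
  -- the assembly
  intro h0
  rw [heightFourOneCoord] at h0
  have heq : padicLog 5 (((x.den : ℚ)) : ℚ_[5]) = padicLog 5 (C2 * S2) := sub_eq_zero.mp h0
  have hB' : ‖C2 * S2 - 25 * ((β : ℤ) : ℚ_[5])‖ ≤ ‖(25 : ℚ_[5])‖ / (5 : ℝ) ^ 3 := by exact_mod_cast hB
  exact padicLog_ne_padicLog_of_unitResidue (P := 25) (by norm_num) (not_five_dvd_sq h5e) h5β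
    (by norm_num : 1 ≤ 3) hA hB' hcert heq

end Height

/-! ### §2 The admissible certificate from one row's integers -/

/-- **`RegMult.CertNonsplit W 5 Q 1` from a SECOND-ORDER depth-one REG5CERT certificate.** As `certNonsplit_of_certDepthOne` with the
residues `(λ, Γ, β)` of `heightFourOneCoord_ne_zero_of_certDepthOneO2` and the certificate **`5³ ∤ β⁴ − e'⁸`**; the single hypothesis `H` is
decided per row by ONE `norm_num`. Per curve; nothing class-wide. [cite: SteinWuthrich2013, §4.2] [cite: MazurSteinTate2006, §1]
[cite: SilvermanAEC2009, VII.3.4] -/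
theorem certNonsplit_of_certDepthOneO2 (W : WeierstrassCurve ℚ) {a₁ a₂ a₃ a₄ a₆ : ℤ} (hW : W = ⟨a₁, a₂, a₃, a₄, a₆⟩)
    [W.IsElliptic] [W.IsGloballyMinimal] {a b c4 c6 lam Γ β : ℤ} {e' n : ℕ}
    (H : c4 = (a₁ ^ 2 + 4 * a₂) ^ 2 - 24 * (2 * a₄ + a₁ * a₃) ∧
      c6 = -(a₁ ^ 2 + 4 * a₂) ^ 3 + 36 * (a₁ ^ 2 + 4 * a₂) * (2 * a₄ + a₁ * a₃) - 216 * (a₃ ^ 2 + 4 * a₆) ∧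
      ¬ (5 : ℤ) ∣ c4 ∧ ¬ (5 : ℤ) ∣ c6 ∧ ¬ (5 : ℤ) ∣ e' ∧ ¬ (5 : ℤ) ∣ b ∧ Nat.Coprime a.natAbs (5 * e') ∧
      Int.gcd (2 * b + a₁ * a * (5 * e' : ℕ) + a₃ * (5 * e' : ℕ) ^ 3)
        (a₁ * b * (5 * e' : ℕ) - (3 * a ^ 2 + 2 * a₂ * a * (5 * e' : ℕ) ^ 2 + a₄ * (5 * e' : ℕ) ^ 4)) ∣ (5 * e') ^ n ∧
      (125 : ℤ) ∣ -6 * a * e' * b ^ 2 + 15 * a₁ * a ^ 2 * e' ^ 2 * b - 50 * (a₁ ^ 2 + a₂) * a ^ 3 * e' ^ 3 - 6 * b ^ 3 * lam ∧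
      ¬ (5 : ℤ) ∣ lam ∧ (5 : ℤ) ∣ c4 + Γ * c6 ∧ (125 : ℤ) ∣ 12 * Γ * β - 12 * Γ * lam ^ 2 - 25 * lam ^ 4 ∧ ¬ (5 : ℤ) ∣ β ∧
      ¬ (5 : ℤ) ^ 3 ∣ β ^ 4 - ((e' : ℤ) ^ 2) ^ 4)
    {x y : ℚ} (hx : x = a / ((5 * e' : ℕ) : ℚ) ^ 2) (hy : y = b / ((5 * e' : ℕ) : ℚ) ^ 3)
    (h : W.toAffine.Nonsingular x y) : RegMult.CertNonsplit W 5 (.some x y h) 1 := by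
  obtain ⟨hc4, hc6, h5c4, h5c6, h5e, h5b, hcop, hgcd, hlam, h5lam, hΓ, hβ, h5β, hcert⟩ := H
  have he'0 : e' ≠ 0 := by rintro rfl; exact h5e (by simp)
  have he0 : (5 * e' : ℕ) ≠ 0 := by positivity
  have hx1 : 1 < ‖(x : ℚ_[5])‖ :=
    (one_lt_norm_ratCast_iff 5 x).mpr (KernelCert.padicValRat_x_neg he0 hx hcop (dvd_mul_right 5 e'))
  have hadm : W.IsAdmissible 5 (.some x y h) :=
    isAdmissible_of_one_lt_norm (by norm_num) h hx1 (KernelCert.hasNonsingularReductionAt_of_gcd W hW he0 hx hy hcop hgcd)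
  refine ⟨by rw [one_smul]; exact hadm, fun q _ hq1 _ => ?_⟩
  rw [one_smul]
  exact heightFourOneCoord_ne_zero_of_certDepthOneO2 W hW hc4 hc6 h5c4 h5c6 h5e h5b hcop hx hy hlam h5lam hΓ hβ h5β hcert hq1

end Summit.BirchSwinnertonDyer.Rank1Residual.X11b.RegMult.KernelCertFive
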